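import Mathlib
import Literature.Computability.AlgebraicComplexity.SetMultilinear

/-!
# Fekete SOS magnification — the polarised set-multilinear transport (`stub_polarisedSOS`)

Route `ValiantsHypothesis/FeketeSOS`, crux item `stmt-ValiantsHypothesis-3995` (`SOSMagnification`),
line `sml-polarised-transport`, stub `stub_polarisedSOS` (the line's lever).

Variables are `Fin n × Fin k` (digit position `j < n`, digit value `ℓ < k`), the block map is
`Prod.fst` (one block per digit position), `π_S := smlProj Prod.fst S` is the set-multilinear
projection onto the block set `S ⊆ Fin n` of the tree file
`Literature/Computability/AlgebraicComplexity/SetMultilinear.lean`.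

Main result `stub_polarisedSOS`: if `P` is set-multilinear over all `n` blocks, `1 ≤ k`, and
`P = ∑_{l<t} g_l h_l` with `deg g_l ≤ D₁`, `deg h_l ≤ D₂`, then
`P = ∑_{i<s} a_i q_i²` with `s ≤ 2^{n+1} t`, every `q_i` having at most `k^{D₁} + k^{D₂}` monomials,
all of them block-sub-multilinear (`∑ ℓ, m (j, ℓ) ≤ 1` for every block `j`).

Proof.
* `P = π_univ P = ∑_l π_univ (g_l h_l) = ∑_l ∑_S π_S g_l · π_{univ ∖ S} h_l` (product formula
  `smlProj_mul`), then polarise `a b = ¼ (a + b)² − ¼ (a − b)²` (`eq_sum_polarised`); the squares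
  are indexed by `(Fin t × Finset (Fin n)) ⊕ (Fin t × Finset (Fin n))`, of cardinality
  `2 · t · 2^n`, transported to `Fin s` along `Fintype.equivFin`.
* Counting (`card_support_smlProj_le`): a monomial of `π_S g` has row sums `[j ∈ S]`
  (`sum_eq_of_mem_support_smlProj`), so it is the indicator of the graph of a function `S → Fin k`
  (at most `k^{#S}` of them) and has degree `#S ≤ deg g ≤ D`; hence `#supp (π_S g) ≤ k^D` for
  `1 ≤ k`, with no binomial coefficient — the point of the line.

Helper lemmas live in the sub-namespace `PolarisedSOS`; no definitions are introduced.
-/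

set_option linter.dupNamespace false

open MvPolynomial
open Literature.Computability.AlgebraicComplexity

namespace Summit.ValiantsHypothesis.ValiantsHypothesis.Theorems.FeketeSOSSOSMagnification

namespace PolarisedSOS

/-! ### Counting the monomials of a set-multilinear projection -/

variable {R : Type*} [CommSemiring R]

/-- The block-degree vector of a monomial `m` over `Fin n × Fin k` for the block map `Prod.fst`,
evaluated at the block `j`, is the row sum `∑ ℓ, m (j, ℓ)`. [folklore] -/
theorem weight_fst_apply {n k : ℕ} (m : Fin n × Fin k →₀ ℕ) (j : Fin n) :
    Finsupp.weight (blockWeight (Prod.fst : Fin n × Fin k → Fin n)) m j =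
      ∑ l : Fin k, m (j, l) := by
  classical
  rw [weight_blockWeight_eq_mapDomain, Finsupp.mapDomain, Finsupp.sum_apply,
    Finsupp.sum_fintype _ _ (fun _ => by simp)]
  simp_rw [Finsupp.single_apply]
  rw [Fintype.sum_prod_type, Finset.sum_comm]
  refine Finset.sum_congr rfl fun l _ => ?_
  rw [Finset.sum_ite_eq']
  simp

/-- A monomial of `smlProj Prod.fst S g` has block-degree vector `blockProfile S` and is a monomial
of `g`. [folklore] -/
theorem weight_eq_and_mem_support_of_mem_support_smlProj {n k : ℕ} (S : Finset (Fin n))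
    (g : MvPolynomial (Fin n × Fin k) R) {m : Fin n × Fin k →₀ ℕ}
    (hm : m ∈ (smlProj (Prod.fst : Fin n × Fin k → Fin n) S g).support) :
    Finsupp.weight (blockWeight (Prod.fst : Fin n × Fin k → Fin n)) m = blockProfile S ∧
      m ∈ g.support := by
  classical
  rw [mem_support_iff, coeff_smlProj] at hm
  by_cases h : Finsupp.weight (blockWeight (Prod.fst : Fin n × Fin k → Fin n)) m = blockProfile S
  · rw [if_pos h] at hm
    exact ⟨h, mem_support_iff.2 hm⟩
  · rw [if_neg h] at hm
    exact absurd rfl hm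

/-- Row sums of a monomial of `smlProj Prod.fst S g`: `∑ ℓ, m (j, ℓ) = [j ∈ S]`. [folklore] -/
theorem sum_eq_of_mem_support_smlProj {n k : ℕ} (S : Finset (Fin n))
    (g : MvPolynomial (Fin n × Fin k) R) {m : Fin n × Fin k →₀ ℕ}
    (hm : m ∈ (smlProj (Prod.fst : Fin n × Fin k → Fin n) S g).support) (j : Fin n) :
    ∑ l : Fin k, m (j, l) = if j ∈ S then 1 else 0 := by
  classical
  rw [← weight_fst_apply, (weight_eq_and_mem_support_of_mem_support_smlProj S g hm).1,
    blockProfile_apply]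

/-- Monomials of `smlProj Prod.fst S g` are block-sub-multilinear: every row sum is `≤ 1`.
[folklore] -/
theorem sum_le_one_of_mem_support_smlProj {n k : ℕ} (S : Finset (Fin n))
    (g : MvPolynomial (Fin n × Fin k) R) {m : Fin n × Fin k →₀ ℕ}
    (hm : m ∈ (smlProj (Prod.fst : Fin n × Fin k → Fin n) S g).support) (j : Fin n) :
    ∑ l : Fin k, m (j, l) ≤ 1 := by
  rw [sum_eq_of_mem_support_smlProj S g hm j]
  split_ifs <;> simp

/-- If `smlProj Prod.fst S g` has a monomial at all, then `S.card ≤ totalDegree g` (the monomial has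
degree exactly `S.card` and is a monomial of `g`). [folklore] -/
theorem card_le_totalDegree_of_mem_support_smlProj {n k : ℕ} (S : Finset (Fin n))
    (g : MvPolynomial (Fin n × Fin k) R) {m : Fin n × Fin k →₀ ℕ}
    (hm : m ∈ (smlProj (Prod.fst : Fin n × Fin k → Fin n) S g).support) :
    S.card ≤ g.totalDegree := by
  classical
  have hdeg := le_totalDegree (weight_eq_and_mem_support_of_mem_support_smlProj S g hm).2
  have hsum : (m.sum fun _ e => e) = S.card := by
    rw [Finsupp.sum_fintype _ _ (fun _ => rfl), Fintype.sum_prod_type]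
    simp_rw [sum_eq_of_mem_support_smlProj S g hm]
    simp
  omega

/-- A function `Fin k → ℕ` with sum `1` and a nonzero value at `l₀` is the indicator of `l₀`.
[folklore] -/
theorem eq_ite_of_sum_eq_one {k : ℕ} (f : Fin k → ℕ) (hf : ∑ l, f l = 1) (l₀ : Fin k)
    (h0 : f l₀ ≠ 0) (l : Fin k) : f l = if l = l₀ then 1 else 0 := by
  classical
  have hsplit := Finset.add_sum_erase Finset.univ f (Finset.mem_univ l₀)
  rw [hf] at hsplit
  split_ifs with hl
  · rw [hl]
    omega
  · have hrest : ∑ x ∈ Finset.univ.erase l₀, f x = 0 := by omega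
    exact Finset.sum_eq_zero_iff.1 hrest l (Finset.mem_erase.2 ⟨hl, Finset.mem_univ l⟩)

/-- **Counting lemma.** For `1 ≤ k` and `totalDegree g ≤ D`, the set-multilinear projection
`smlProj Prod.fst S g` has at most `k ^ D` monomials: each monomial is the indicator of the graph of
a function `S → Fin k` (so there are at most `k ^ S.card` of them), and `S.card ≤ D` as soon as
there is one. [folklore] -/
theorem card_support_smlProj_le {n k D : ℕ} (hk : 1 ≤ k) (S : Finset (Fin n))
    (g : MvPolynomial (Fin n × Fin k) R) (hg : g.totalDegree ≤ D) :
    (smlProj (Prod.fst : Fin n × Fin k → Fin n) S g).support.card ≤ k ^ D := by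
  classical
  rcases (smlProj (Prod.fst : Fin n × Fin k → Fin n) S g).support.eq_empty_or_nonempty with
    hempty | ⟨m₀, hm₀⟩
  · rw [hempty, Finset.card_empty]
    exact Nat.zero_le _
  have hSD : S.card ≤ D := (card_le_totalDegree_of_mem_support_smlProj S g hm₀).trans hg
  calc (smlProj (Prod.fst : Fin n × Fin k → Fin n) S g).support.card
      ≤ (Finset.univ : Finset (S → Fin k)).card := by
        refine Finset.card_le_card_of_surjOn
          (fun c : S → Fin k => Finsupp.equivFunOnFinite.symm (fun v : Fin n × Fin k =>
            if h : v.1 ∈ S then (if c ⟨v.1, h⟩ = v.2 then 1 else 0) else 0)) ?_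
        intro m hm
        have hrow := sum_eq_of_mem_support_smlProj S g (Finset.mem_coe.1 hm)
        have hex : ∀ j : S, ∃ l : Fin k, m (j, l) ≠ 0 := by
          intro j
          have h1 := hrow j
          rw [if_pos j.2] at h1
          obtain ⟨l, -, hl⟩ := Finset.exists_ne_zero_of_sum_ne_zero (h1.trans_ne one_ne_zero)
          exact ⟨l, hl⟩
        choose c hc using hex
        refine ⟨c, Finset.mem_coe.2 (Finset.mem_univ c), ?_⟩
        ext ⟨j, l⟩
        simp only [Finsupp.coe_equivFunOnFinite_symm]
        by_cases hj : j ∈ S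
        · rw [dif_pos hj, eq_ite_of_sum_eq_one (fun l => m (j, l)) (by rw [hrow j, if_pos hj])
            (c ⟨j, hj⟩) (hc ⟨j, hj⟩) l]
          by_cases hl : l = c ⟨j, hj⟩
          · rw [if_pos hl, if_pos hl.symm]
          · rw [if_neg hl, if_neg (Ne.symm hl)]
        · rw [dif_neg hj]
          have h1 := hrow j
          rw [if_neg hj] at h1
          exact (Finset.sum_eq_zero_iff.1 h1 l (Finset.mem_univ l)).symm
    _ = k ^ S.card := by simp
    _ ≤ k ^ D := Nat.pow_le_pow_right hk hSD

/-! ### Polarisation and the main statement -/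

/-- **Polarisation** over `ℂ`: `a · b = ¼ (a + b)² − ¼ (a − b)²`, written as a weighted sum of two
squares with constant coefficients `C 4⁻¹`, `C (−4⁻¹)`. [folklore] -/
theorem polarise {σ : Type*} (a b : MvPolynomial σ ℂ) :
    a * b = C (4⁻¹ : ℂ) * (a + b) ^ 2 + C (-4⁻¹ : ℂ) * (a - b) ^ 2 := by
  have hC : C (4 : ℂ)⁻¹ * (4 : MvPolynomial σ ℂ) = 1 := by
    rw [← map_ofNat C 4, ← C_mul, inv_mul_cancel₀ (by norm_num : (4 : ℂ) ≠ 0), C_1]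
  have key : C (4⁻¹ : ℂ) * (a + b) ^ 2 + C (-4⁻¹ : ℂ) * (a - b) ^ 2 =
      C (4 : ℂ)⁻¹ * (4 : MvPolynomial σ ℂ) * (a * b) := by
    rw [map_neg]
    ring
  rw [key, hC, one_mul]

/-- **The polarised set-multilinear expansion.** If `P` is set-multilinear over all `n` blocks and
`P = ∑ l, g l * h l`, then
`P = ∑_{(l,S)} ¼ (π_S g_l + π_{Sᶜ} h_l)² − ∑_{(l,S)} ¼ (π_S g_l − π_{Sᶜ} h_l)²`,
where `π_S = smlProj Prod.fst S` and `S` ranges over all subsets of `Fin n`: project the identity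
onto the set-multilinear part (`smlProj_mul`) and polarise each product. [folklore] -/
theorem eq_sum_polarised {n k t : ℕ} (P : MvPolynomial (Fin n × Fin k) ℂ)
    (g h : Fin t → MvPolynomial (Fin n × Fin k) ℂ)
    (hP : IsSetMultilinear (Prod.fst : Fin n × Fin k → Fin n) Finset.univ P)
    (hPgh : P = ∑ l, g l * h l) :
    P = ∑ x : Fin t × Finset (Fin n),
          C (4⁻¹ : ℂ) * (smlProj (Prod.fst : Fin n × Fin k → Fin n) x.2 (g x.1) +
            smlProj (Prod.fst : Fin n × Fin k → Fin n) (Finset.univ \ x.2) (h x.1)) ^ 2 +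
        ∑ x : Fin t × Finset (Fin n),
          C (-4⁻¹ : ℂ) * (smlProj (Prod.fst : Fin n × Fin k → Fin n) x.2 (g x.1) -
            smlProj (Prod.fst : Fin n × Fin k → Fin n) (Finset.univ \ x.2) (h x.1)) ^ 2 := by
  classical
  calc P = smlProj (Prod.fst : Fin n × Fin k → Fin n) Finset.univ P := (hP.smlProj_eq _).symm
    _ = ∑ l, smlProj (Prod.fst : Fin n × Fin k → Fin n) Finset.univ (g l * h l) := by
        rw [hPgh, map_sum]
    _ = ∑ l, ∑ S : Finset (Fin n), smlProj (Prod.fst : Fin n × Fin k → Fin n) S (g l) *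
          smlProj (Prod.fst : Fin n × Fin k → Fin n) (Finset.univ \ S) (h l) := by
        refine Finset.sum_congr rfl fun l _ => ?_
        rw [smlProj_mul, Finset.powerset_univ]
    _ = ∑ x : Fin t × Finset (Fin n), smlProj (Prod.fst : Fin n × Fin k → Fin n) x.2 (g x.1) *
          smlProj (Prod.fst : Fin n × Fin k → Fin n) (Finset.univ \ x.2) (h x.1) := by
        rw [Fintype.sum_prod_type]
    _ = _ := by
        rw [← Finset.sum_add_distrib]
        exact Finset.sum_congr rfl fun x _ => polarise _ _

/-- Support of a combination `q` of `π_S g` and `π_T h` (with `supp q ⊆ supp π_S g ∪ supp π_T h`):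
at most `k ^ D₁ + k ^ D₂` monomials, all block-sub-multilinear. [folklore] -/
theorem support_bounds {n k D₁ D₂ : ℕ} (hk : 1 ≤ k) (S T : Finset (Fin n))
    (g h q : MvPolynomial (Fin n × Fin k) ℂ) (hg : g.totalDegree ≤ D₁) (hh : h.totalDegree ≤ D₂)
    (hq : q.support ⊆ (smlProj (Prod.fst : Fin n × Fin k → Fin n) S g).support ∪
      (smlProj (Prod.fst : Fin n × Fin k → Fin n) T h).support) :
    q.support.card ≤ k ^ D₁ + k ^ D₂ ∧
      ∀ m ∈ q.support, ∀ j : Fin n, ∑ l : Fin k, m (j, l) ≤ 1 := by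
  refine ⟨(Finset.card_le_card hq).trans ((Finset.card_union_le _ _).trans
    (Nat.add_le_add (card_support_smlProj_le hk S g hg) (card_support_smlProj_le hk T h hh))),
    fun m hm j => ?_⟩
  rcases Finset.mem_union.1 (hq hm) with h1 | h1
  · exact sum_le_one_of_mem_support_smlProj S g h1 j
  · exact sum_le_one_of_mem_support_smlProj T h h1 j

end PolarisedSOS

open PolarisedSOS in
/-- **Stub `stub_polarisedSOS` (the lever of line `sml-polarised-transport`).** Let `P` be
set-multilinear over the `n` digit blocks of `Fin n × Fin k` (`1 ≤ k`) with a bilinear-cut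
representation `P = ∑_{l<t} g_l h_l`, `deg g_l ≤ D₁`, `deg h_l ≤ D₂`.  Then `P` is a weighted sum of
`s ≤ 2^{n+1} t` squares `P = ∑ i, C (a i) * q_i²` where every `q_i` has at most `k^{D₁} + k^{D₂}`
monomials, all of which take at most one variable (with multiplicity) from each block.  Proof:
`P = π_univ P = ∑_l ∑_S π_S g_l · π_{univ∖S} h_l` (`smlProj_mul`), polarise
`4ab = (a+b)² − (a−b)²`, and count the monomials of a set-multilinear projection
(`card_support_smlProj_le`). [folklore] -/
theorem stub_polarisedSOS :
    ∀ (n k t D₁ D₂ : ℕ) (P : MvPolynomial (Fin n × Fin k) ℂ)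
      (g h : Fin t → MvPolynomial (Fin n × Fin k) ℂ),
      1 ≤ k → IsSetMultilinear (Prod.fst : Fin n × Fin k → Fin n) Finset.univ P →
      P = ∑ l, g l * h l → (∀ l, (g l).totalDegree ≤ D₁) → (∀ l, (h l).totalDegree ≤ D₂) →
      ∃ (s : ℕ) (a : Fin s → ℂ) (q : Fin s → MvPolynomial (Fin n × Fin k) ℂ),
        s ≤ 2 ^ (n + 1) * t ∧
        P = ∑ i, C (a i) * q i ^ 2 ∧
        (∀ i, (q i).support.card ≤ k ^ D₁ + k ^ D₂) ∧
        (∀ i, ∀ m ∈ (q i).support, ∀ j : Fin n, ∑ l : Fin k, m (j, l) ≤ 1) := by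
  intro n k t D₁ D₂ P g h hk hP hPgh hg hh
  classical
  -- the representation indexed by `ι := (Fin t × Finset (Fin n)) ⊕ (Fin t × Finset (Fin n))`
  obtain ⟨A, Q, hPQ, hQ⟩ : ∃ (A : (Fin t × Finset (Fin n)) ⊕ (Fin t × Finset (Fin n)) → ℂ)
      (Q : (Fin t × Finset (Fin n)) ⊕ (Fin t × Finset (Fin n)) → MvPolynomial (Fin n × Fin k) ℂ),
      P = ∑ x, C (A x) * Q x ^ 2 ∧
      ∀ x, (Q x).support.card ≤ k ^ D₁ + k ^ D₂ ∧
        ∀ m ∈ (Q x).support, ∀ j : Fin n, ∑ l : Fin k, m (j, l) ≤ 1 := by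
    refine ⟨Sum.elim (fun _ => 4⁻¹) (fun _ => -4⁻¹),
      Sum.elim
        (fun x => smlProj (Prod.fst : Fin n × Fin k → Fin n) x.2 (g x.1) +
          smlProj (Prod.fst : Fin n × Fin k → Fin n) (Finset.univ \ x.2) (h x.1))
        (fun x => smlProj (Prod.fst : Fin n × Fin k → Fin n) x.2 (g x.1) -
          smlProj (Prod.fst : Fin n × Fin k → Fin n) (Finset.univ \ x.2) (h x.1)), ?_, ?_⟩
    · rw [eq_sum_polarised P g h hP hPgh, Fintype.sum_sum_type]
      simp only [Sum.elim_inl, Sum.elim_inr]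
    · rintro (⟨l, S⟩ | ⟨l, S⟩)
      · simp only [Sum.elim_inl]
        exact support_bounds hk S (Finset.univ \ S) (g l) (h l) _ (hg l) (hh l) support_add
      · simp only [Sum.elim_inr]
        exact support_bounds hk S (Finset.univ \ S) (g l) (h l) _ (hg l) (hh l)
          (support_sub _ _ _)
  -- transport to `Fin s`
  let e := Fintype.equivFin ((Fin t × Finset (Fin n)) ⊕ (Fin t × Finset (Fin n)))
  refine ⟨Fintype.card ((Fin t × Finset (Fin n)) ⊕ (Fin t × Finset (Fin n))),
    fun i => A (e.symm i), fun i => Q (e.symm i), ?_, ?_, fun i => (hQ _).1, fun i => (hQ _).2⟩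
  · simp only [Fintype.card_sum, Fintype.card_prod, Fintype.card_fin, Fintype.card_finset]
    rw [pow_succ]
    exact le_of_eq (by ring)
  · rw [hPQ]
    exact (Equiv.sum_comp e.symm (fun x => C (A x) * Q x ^ 2)).symm

end Summit.ValiantsHypothesis.ValiantsHypothesis.Theorems.FeketeSOSSOSMagnification
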